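/-
Copyright (c) 2026 the pub-hodgecm-mathlib formalisation cell (harness21).  Prover seat hodgecm-mathlib-K2E3-p14 (g6), Track B «K2-LIT» ∕ h413
(`stmt-HodgeConjecture-24833`), line `K2_E3_EllipticInputs`, road (11-3-split-nsc), leaf (nsc-S-A′) «principal-block standard span», brick E2-R:
THE TWO SPELLINGS OF THE `GL₂` PRINCIPAL SERIES (`id : Fin 2 → Fin 2` versus `lastBlockLabel 2`) ARE THE SAME REPRESENTATION.  2026-09-04.
-/
import Literature.NumberTheory.Automorphic.Zelevinsky1980.RankTwoDetCharSelfIrreducible       -- ★ `coe_det_leviProjection_lastBlockLabel_two_false/true`, brings `maxParabolicLeviChar`, `lastBlockLabel`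
import Literature.NumberTheory.Automorphic.GLnMaximalParabolicLocalModulus                   -- ★ `rootDeltaChar_standardParabolicGL_lastBlockLabel`
import Literature.NumberTheory.Automorphic.PrincipalSeriesGL2SatakeParameters                -- ★ `coe_rootDeltaChar_standardParabolicGL_fin_two`
import Summits.HodgeConjecture.HodgeConjecture.Theorems.K2E3GL3InductionInStagesEmbedding     -- ★ `det_leviProjection_id_eq_entry`
import HarnessLib

/-!
# K2_E3 road (h413), (11-3-split-nsc) leaf (nsc-S-A′), brick E2-R — the `GL₂` principal series in the `id`-labelling and in the `lastBlockLabel 2`-labelling agree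

Cell `pub/hodgecm-mathlib` (D-0151), Track B, seat K2E3-p14 (g6); leaf architecture K2E3-p25 (g0): the leaf and brick E2-I speak `I ![x,y] = parabolicIndGL F id
(𝟙 ⊗ tch ![x,y])` (HEADS 2026-09-04 08:40:11Z) while the `GL₂` exponent bricks G1 ∕ G2 speak `I₂ x y = parabolicIndGL F (lastBlockLabel 2) (𝟙 ⊗ maxParabolicLeviChar F 2 x y)`
(ruling 08:48:59Z «the GL₂ slot speaks `lastBlockLabel 2` … E2 carries the reindex»).  This brick is that reindex: an explicit equivalence, the IDENTITY on functions
`GL₂(F) → ℂ`.  `--supports stmt-HodgeConjecture-24833 --as helper`; THEOREMS ONLY; never imports `Cruxes/…/Lines`.  COUNT-NEUTRAL.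

THE MATHEMATICS (trivial bookkeeping): the standard parabolics of `GL₂(F)` for the labellings `id : Fin 2 → Fin 2` and `lastBlockLabel 2 = ![false, true]` are the
SAME subgroup (upper triangular matrices), the inducing characters `(x ⊗ y) ∘ proj_id ⊗ δ^{1∕2}` and `maxParabolicLeviChar F 2 x y ∘ proj ⊗ δ^{1∕2}` take the same values
`x(b₀₀) y(b₁₁) ‖b₀₀∕b₁₁‖^{1∕2}` (★ `coe_rootDeltaChar_standardParabolicGL_fin_two`, ★ `rootDeltaChar_standardParabolicGL_lastBlockLabel`), so the two normalised inductions
are literally the same space of functions with the same action.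

* §1 **`exists_equiv_smoothIndRep_of_eq`** — generic: `H₁ = H₂` and inducing representations agreeing on elements ⇒ `Ind_{H₁} σ₁ ≃ Ind_{H₂} σ₂`, identity on
  functions;
* §2 `standardParabolicGL_id_eq_lastBlockLabel_two`, `inducing_character_id_eq_lastBlockLabel_two`,
  **`exists_equiv_parabolicIndGL_id_lastBlockLabel_two`** — `∃ Φ : I ![x,y] ≃ I₂ x y, ∀ f g, (Φ f).toFun g = f.toFun g`.

HONEST LABEL: HC_CM is proved only modulo the 7 printed citations (2 remaining named inputs: hLiu418 = stmt-HodgeConjecture-24832, h413 =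
stmt-HodgeConjecture-24833) until rung 0 closes; count-neutral helper.

## References
* [BernsteinZelevinsky1977] I. N. Bernstein, A. V. Zelevinsky, *Induced representations of reductive 𝔭-adic groups I*, Ann. Sci. ÉNS 10 (1977): §2.1–2.3.
* [Zelevinsky1980] A. V. Zelevinsky, *Induced representations of reductive 𝔭-adic groups II*, Ann. Sci. ÉNS 13 (1980): §1.1, §3.2 Example p. 181.
-/

set_option autoImplicit false
set_option linter.dupNamespace false

noncomputable section

open scoped MatrixGroups NNReal

namespace Summit.HodgeConjecture.HodgeConjecture.Cruxes.H413.K2E3GL2BorelRelabelEquiv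

open Literature.NumberTheory.Automorphic Literature.NumberTheory.Automorphic.Zelevinsky1980
open Literature.NumberTheory.GaloisRepresentations Literature.NumberTheory.GaloisRepresentations.IsNonarchimedeanLocalField

/-! ## §1 Induction from equal subgroups with equal inducing data -/

section Generic

variable {k G W : Type*} [CommRing k] [Group G] [TopologicalSpace G] [SeparatelyContinuousMul G] [AddCommGroup W] [Module k W]

/-- **Induction does not see the spelling of the subgroup**: if `H₁ = H₂` as subgroups and the inducing representations agree on every element, then
`Ind_{H₁}^G σ₁ ≃ Ind_{H₂}^G σ₂` by an equivalence that is the identity on the underlying functions `G → W`. [cite: BernsteinZelevinsky1977, §2.3] -/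
theorem exists_equiv_smoothIndRep_of_eq {H₁ H₂ : Subgroup G} (h : H₁ = H₂) (σ₁ : Representation k H₁ W) (σ₂ : Representation k H₂ W)
    (hσ : ∀ (g : G) (h₁ : g ∈ H₁) (h₂ : g ∈ H₂), σ₁ ⟨g, h₁⟩ = σ₂ ⟨g, h₂⟩) :
    ∃ Φ : (Representation.smoothIndRep H₁ σ₁).Equiv (Representation.smoothIndRep H₂ σ₂),
      ∀ (f : Representation.SmoothInd H₁ σ₁) (g : G), (Φ f).toFun g = f.toFun g := by
  subst h
  obtain rfl : σ₁ = σ₂ := MonoidHom.ext fun p => hσ p.1 p.2 p.2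
  exact ⟨Representation.Equiv.refl _, fun f g => rfl⟩

end Generic

/-! ## §2 The Borel of `GL₂(F)` in the two labellings -/

section GL2

variable {F : Type*} [Field F]

/-- The standard parabolic of `GL₂` for `id : Fin 2 → Fin 2` and for `lastBlockLabel 2 = ![false, true]` is the same subgroup (upper triangular matrices).
[cite: BernsteinZelevinsky1977, §2.1] -/
theorem standardParabolicGL_id_eq_lastBlockLabel_two :
    standardParabolicGL F (id : Fin 2 → Fin 2) = standardParabolicGL F (lastBlockLabel 2) := by
  refine Subgroup.ext fun g => ?_
  rw [mem_standardParabolicGL_iff, mem_standardParabolicGL_iff]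
  constructor
  · intro hg i j hij
    refine hg ?_
    revert hij
    fin_cases i <;> fin_cases j <;> simp [lastBlockLabel]
  · intro hg i j hij
    refine hg ?_
    revert hij
    fin_cases i <;> fin_cases j <;> simp [lastBlockLabel]

variable [ValuativeRel F] [TopologicalSpace F] [IsNonarchimedeanLocalField F]

/-- **The inducing characters agree**: for `b` upper triangular in `GL₂(F)`,
`δ_{id}^{1∕2}(b) · (x ⊗ y)(proj_id b) · c = δ_{lbl}^{1∕2}(b) · maxParabolicLeviChar F 2 x y (proj_lbl b) · c` (both are `‖b₀₀∕b₁₁‖^{1∕2} x(b₀₀) y(b₁₁) c`).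
[cite: Zelevinsky1980, §3.2 Example p. 181] [cite: BernsteinZelevinsky1977, §2.3] -/
theorem inducing_character_id_eq_lastBlockLabel_two (x y : Fˣ →* ℂˣ) (g : GL (Fin 2) F)
    (h₁ : g ∈ standardParabolicGL F (id : Fin 2 → Fin 2)) (h₂ : g ∈ standardParabolicGL F (lastBlockLabel 2)) :
    (Representation.twist
        (((Representation.trivial ℂ (Π a : Fin 2, GL {i : Fin 2 // (id : Fin 2 → Fin 2) i = a} F) ℂ).twist
          (∏ a : Fin 2, ((![x, y] : Fin 2 → (Fˣ →* ℂˣ)) a).comp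
            (Matrix.GeneralLinearGroup.det.comp (Pi.evalMonoidHom (fun a : Fin 2 => GL {i : Fin 2 // (id : Fin 2 → Fin 2) i = a} F) a)))).comp
          (leviProjection F (id : Fin 2 → Fin 2)))
        (rootDeltaChar (standardParabolicGL F (id : Fin 2 → Fin 2)))) ⟨g, h₁⟩ =
      (Representation.twist
        (((Representation.trivial ℂ (Π a : Bool, GL {i : Fin 2 // lastBlockLabel 2 i = a} F) ℂ).twist (maxParabolicLeviChar F 2 x y)).comp
          (leviProjection F (lastBlockLabel 2)))
        (rootDeltaChar (standardParabolicGL F (lastBlockLabel 2)))) ⟨g, h₂⟩ := by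
  -- the units `det` of the `1 × 1` blocks agree
  have hu0 : Matrix.GeneralLinearGroup.det (leviProjection F (id : Fin 2 → Fin 2) ⟨g, h₁⟩ 0) =
      Matrix.GeneralLinearGroup.det (leviProjection F (lastBlockLabel 2) ⟨g, h₂⟩ false) := by
    refine Units.ext ?_
    rw [K2E3GL3InductionInStagesEmbedding.det_leviProjection_id_eq_entry, coe_det_leviProjection_lastBlockLabel_two_false]
  have hu1 : Matrix.GeneralLinearGroup.det (leviProjection F (id : Fin 2 → Fin 2) ⟨g, h₁⟩ 1) =
      Matrix.GeneralLinearGroup.det (leviProjection F (lastBlockLabel 2) ⟨g, h₂⟩ true) := by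
    refine Units.ext ?_
    rw [K2E3GL3InductionInStagesEmbedding.det_leviProjection_id_eq_entry, coe_det_leviProjection_lastBlockLabel_two_true]
  -- the two `δ^{1/2}`
  have hδ : ((rootDeltaChar (standardParabolicGL F (id : Fin 2 → Fin 2)) ⟨g, h₁⟩ : ℂˣ) : ℂ) =
      ((rootDeltaChar (standardParabolicGL F (lastBlockLabel 2)) ⟨g, h₂⟩ : ℂˣ) : ℂ) := by
    rw [coe_rootDeltaChar_standardParabolicGL_fin_two, rootDeltaChar_standardParabolicGL_lastBlockLabel F (by norm_num : 1 ≤ 2),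
      coe_det_leviProjection_lastBlockLabel_two_false, coe_det_leviProjection_lastBlockLabel_two_true]
    simp [div_eq_mul_inv]
  refine LinearMap.ext fun c => ?_
  simp only [Representation.twist_apply, MonoidHom.coe_comp, Function.comp_apply, Representation.trivial_apply,
    maxParabolicLeviChar_apply, Fin.prod_univ_two, MonoidHom.mul_apply, Pi.evalMonoidHom_apply, Matrix.cons_val_zero, Matrix.cons_val_one,
    hu0, hu1, hδ, smul_eq_mul]

/-- **BRICK E2-R — `I ![x,y] ≃ I₂ x y`, THE IDENTITY ON FUNCTIONS.**  The `GL₂` principal series in the leaf's `id`-currency,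
`parabolicIndGL F id (𝟙 ⊗ ∏ (![x,y] a ∘ det ∘ eval a))`, and in the G1∕G2 currency, `parabolicIndGL F (lastBlockLabel 2) (𝟙 ⊗ maxParabolicLeviChar F 2 x y)`, are
equivalent by `f ↦ f` (§1 + §2). [cite: Zelevinsky1980, §3.2 Example p. 181] [cite: BernsteinZelevinsky1977, §2.3] -/
theorem exists_equiv_parabolicIndGL_id_lastBlockLabel_two (x y : Fˣ →* ℂˣ) :
    ∃ Φ : (Representation.parabolicIndGL F (id : Fin 2 → Fin 2)
        ((Representation.trivial ℂ (Π a : Fin 2, GL {i : Fin 2 // (id : Fin 2 → Fin 2) i = a} F) ℂ).twist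
          (∏ a : Fin 2, ((![x, y] : Fin 2 → (Fˣ →* ℂˣ)) a).comp
            (Matrix.GeneralLinearGroup.det.comp (Pi.evalMonoidHom (fun a : Fin 2 => GL {i : Fin 2 // (id : Fin 2 → Fin 2) i = a} F) a))))).Equiv
      (Representation.parabolicIndGL F (lastBlockLabel 2)
        ((Representation.trivial ℂ (Π a : Bool, GL {i : Fin 2 // lastBlockLabel 2 i = a} F) ℂ).twist (maxParabolicLeviChar F 2 x y))),
      ∀ f (g : GL (Fin 2) F), (Φ f).toFun g = f.toFun g :=
  exists_equiv_smoothIndRep_of_eq standardParabolicGL_id_eq_lastBlockLabel_two _ _ (inducing_character_id_eq_lastBlockLabel_two x y)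

end GL2

end Summit.HodgeConjecture.HodgeConjecture.Cruxes.H413.K2E3GL2BorelRelabelEquiv

end
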